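import Summits.HodgeConjecture.CorCM.IrreducibleOddWeightsCommutantSeparation
import HarnessLib

/-!
# Row spaces over the commutant, III: the D₄ BLOCK in an ABSOLUTELY IRREDUCIBLE model of any dimension — odd moment
# coordinates on one pair of model vectors forbid interaction (gen 68's 2-adic obstruction, freed from the plane)

COR-CM (cell `pub-hodgecm2`, binder seat `b16` gen 69, count-neutral claim ROW SPACES OVER THE COMMUTANT, file Q8 —
abstract model level; theorems only, no definition, no named fact, no `sorry`).  NEW as stated, hence under `Summits/`.
HONEST FRAMING: a MODEL theorem (the linear action and the factorisation of both slots' shadow translates through it are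
hypotheses to be verified per configuration); it combines file Q1 (`separate_of_isIrreducible_of_forall_smul`: absolute
irreducibility ⟹ separation of rank-one coefficients) with gen 68 P5 (`dual_ne_smul_of_odd`, the 2-adic obstruction, and
`typeRank_sigmaType_add_card_eq_of_moment_not_parallel`).  `HC_CM` is neither used nor asserted.

WHY.  Gen 68 P6 proved «odd × odd indices are additive» on the dihedral PLANE (two model vectors `b₁, b₂` spanning `V`,
the operators `R, S` verified by hand).  This generation's commutant census (numerics, `census/commutant.py`): of the 49
positional base pairs of gen 67's universe, 46 have ABSOLUTELY IRREDUCIBLE odd weight modules of dimension 4 (all the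
(8,8) twins with closures of orders 32, 48, 64, 128), 2 the D₄ plane, 1 (`C₂ × S₃`) a reducible module; the order-16 twins
have commutant `ℚ(√2)`.  For an absolutely irreducible `V` of ANY dimension no spanning pair and no explicit operators are
needed: Q1 supplies the separation, and the obstruction only needs ONE pair of model vectors `b₁, b₂` on which the two
moment functionals have the D₄ shape — `φ₀(b₁), φ₀(b₂)` odd and `φ₁(b₁ + b₂), φ₁(b₁ − b₂)` odd.

* **`typeRank_sigmaType_add_card_eq_of_forall_smul_of_odd_block`**: `π` irreducible with scalar commutant, shadow
  translates of both slots factoring through `π` with moment functionals `φ₀, φ₁`, and a D₄ block as above ⟹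
  `rank(Φ₀,Φ₁) + 2 = rank Φ₀ + rank Φ₁ + 1` (ADDITIVE).
* **`typeRank_sigmaType_add_card_eq_of_forall_smul_of_odd_block'`**: the same with the roles of the block exchanged
  (`φ₁(b₁), φ₁(b₂)` odd, `φ₀(b₁ + b₂), φ₀(b₁ − b₂)` odd).

## References

* [Gordon1999HodgeAVSurvey] B. B. Gordon, *A survey of the Hodge conjecture for abelian varieties*, §3 Theorem, 7.5–7.7,
  9.4.3.
* [Lang2002] S. Lang, *Algebra*, 3rd ed., XVII §3.
* [Serre1977] J.-P. Serre, *Linear Representations of Finite Groups*, GTM 42, §2.2.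
-/

set_option autoImplicit false

noncomputable section

open scoped BigOperators Classical

universe u v v' v'' w

namespace Summit.HodgeConjecture.CorCM.IrrOdd

open Literature.NumberTheory.ComplexMultiplication

variable {G : Type w} [Group G] {V : Type v} [AddCommGroup V] [Module ℚ V]
  {I : Type u} {E : I → Type v} [∀ i, MulAction G (E i)] [∀ i, Fintype (E i)] [Fintype I] [∀ i, Nonempty (E i)]
  {Y₀ : Type v'} [DecidableEq Y₀] [MulAction G Y₀] {Y₁ : Type v''} [DecidableEq Y₁] [MulAction G Y₁]

/-- **THE D₄ BLOCK IN AN ABSOLUTELY IRREDUCIBLE MODEL FORBIDS INTERACTION.**  Rank-one model of gen 68 P5 over a Mathlib-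
irreducible `π` all of whose intertwining operators are scalars; if for some model vectors `b₁, b₂` the moment
coordinates `φ₀(b₁), φ₀(b₂), φ₁(b₁ + b₂), φ₁(b₁ − b₂)` are ODD integers, then `rank(Φ₀,Φ₁) + 2 = rank Φ₀ + rank Φ₁ + 1`.
[cite: Gordon1999HodgeAVSurvey, §3 Theorem, 7.5–7.7 and 9.4.3] [cite: Lang2002, XVII §3] -/
theorem typeRank_sigmaType_add_card_eq_of_forall_smul_of_odd_block {ρ : G} {Φ : ∀ i, Set (E i)}
    (h : ∀ i, IsCMTypeWith ρ (Φ i)) {i₀ i₁ : I} (hI : ∀ j, j = i₀ ∨ j = i₁) (h01 : i₀ ≠ i₁)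
    (r₀ : E i₀ → Y₀) (r₁ : E i₁ → Y₁) (hr₀ : ∀ (g : G) (x : E i₀), r₀ (g • x) = g • r₀ x)
    (hr₁ : ∀ (g : G) (x : E i₁), r₁ (g • x) = g • r₁ x)
    (hfine₀ : ∀ x x' : E i₀, r₀ x = r₀ x' → ∃ n : G, (∀ y : E i₁, n • y = y) ∧ n • x = x')
    (hfine₁ : ∀ x x' : E i₁, r₁ x = r₁ x' → ∃ n : G, (∀ y : E i₀, n • y = y) ∧ n • x = x')
    (π : Representation ℚ G V) [π.IsIrreducible]
    (habs : ∀ d : π.IntertwiningMap π, ∃ t : ℚ, d.toLinearMap = t • LinearMap.id)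
    {φ₀ φ₁ : Module.Dual ℚ V} (e₀ : Y₀ → V) (e₁ : Y₁ → V)
    (hw₀ : ∀ (y : Y₀) (g : G), ∑ x ∈ Finset.univ.filter (fun x => r₀ x = g • y), antiVec (Φ i₀) (1 : G) x =
      φ₀ (π g (e₀ y)))
    (hw₁ : ∀ (y : Y₁) (g : G), ∑ x ∈ Finset.univ.filter (fun x => r₁ x = g • y), antiVec (Φ i₁) (1 : G) x =
      φ₁ (π g (e₁ y)))
    {b₁ b₂ : V} {α β a b : ℤ} (hα : Odd α) (hβ : Odd β) (ha : Odd a) (hb : Odd b) (h0₁ : φ₀ b₁ = α)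
    (h0₂ : φ₀ b₂ = β) (h1₁ : φ₁ (b₁ + b₂) = a) (h1₂ : φ₁ (b₁ - b₂) = b) :
    typeRank G (sigmaType Φ) + Fintype.card I = (∑ i, typeRank G (Φ i)) + 1 :=
  typeRank_sigmaType_add_card_eq_of_moment_not_parallel h hI h01 r₀ r₁ hr₀ hr₁ hfine₀ hfine₁ π
    (separate_of_isIrreducible_of_forall_smul π habs)
    (Summit.HodgeConjecture.CorCM.dual_ne_smul_of_odd hα hβ ha hb h0₁ h0₂ h1₁ h1₂) e₀ e₁ hw₀ hw₁

/-- The same with the block on the other side: `φ₁(b₁), φ₁(b₂)` odd and `φ₀(b₁ + b₂), φ₀(b₁ − b₂)` odd ⟹ additive.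
[cite: Gordon1999HodgeAVSurvey, §3 Theorem, 7.5–7.7 and 9.4.3] [cite: Lang2002, XVII §3] -/
theorem typeRank_sigmaType_add_card_eq_of_forall_smul_of_odd_block' {ρ : G} {Φ : ∀ i, Set (E i)}
    (h : ∀ i, IsCMTypeWith ρ (Φ i)) {i₀ i₁ : I} (hI : ∀ j, j = i₀ ∨ j = i₁) (h01 : i₀ ≠ i₁)
    (r₀ : E i₀ → Y₀) (r₁ : E i₁ → Y₁) (hr₀ : ∀ (g : G) (x : E i₀), r₀ (g • x) = g • r₀ x)
    (hr₁ : ∀ (g : G) (x : E i₁), r₁ (g • x) = g • r₁ x)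
    (hfine₀ : ∀ x x' : E i₀, r₀ x = r₀ x' → ∃ n : G, (∀ y : E i₁, n • y = y) ∧ n • x = x')
    (hfine₁ : ∀ x x' : E i₁, r₁ x = r₁ x' → ∃ n : G, (∀ y : E i₀, n • y = y) ∧ n • x = x')
    (π : Representation ℚ G V) [π.IsIrreducible]
    (habs : ∀ d : π.IntertwiningMap π, ∃ t : ℚ, d.toLinearMap = t • LinearMap.id)
    {φ₀ φ₁ : Module.Dual ℚ V} (e₀ : Y₀ → V) (e₁ : Y₁ → V)
    (hw₀ : ∀ (y : Y₀) (g : G), ∑ x ∈ Finset.univ.filter (fun x => r₀ x = g • y), antiVec (Φ i₀) (1 : G) x =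
      φ₀ (π g (e₀ y)))
    (hw₁ : ∀ (y : Y₁) (g : G), ∑ x ∈ Finset.univ.filter (fun x => r₁ x = g • y), antiVec (Φ i₁) (1 : G) x =
      φ₁ (π g (e₁ y)))
    {b₁ b₂ : V} {α β a b : ℤ} (hα : Odd α) (hβ : Odd β) (ha : Odd a) (hb : Odd b) (h1₁ : φ₁ b₁ = α)
    (h1₂ : φ₁ b₂ = β) (h0₁ : φ₀ (b₁ + b₂) = a) (h0₂ : φ₀ (b₁ - b₂) = b) :
    typeRank G (sigmaType Φ) + Fintype.card I = (∑ i, typeRank G (Φ i)) + 1 := by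
  refine typeRank_sigmaType_add_card_eq_of_moment_not_parallel h hI h01 r₀ r₁ hr₀ hr₁ hfine₀ hfine₁ π
    (separate_of_isIrreducible_of_forall_smul π habs) (fun t ht => ?_) e₀ e₁ hw₀ hw₁
  -- `φ₀ = t φ₁` with `φ₀ ≠ 0` (its value `a` at `b₁ + b₂` is odd) gives `t ≠ 0` and `φ₁ = t⁻¹ φ₀`
  have ha0 : (a : ℚ) ≠ 0 := by
    obtain ⟨k, rfl⟩ := ha
    have hk : (2 * k + 1 : ℤ) ≠ 0 := by omega
    exact_mod_cast hk
  have ht0 : t ≠ 0 := by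
    rintro rfl
    rw [zero_smul] at ht
    rw [ht, LinearMap.zero_apply] at h0₁
    exact ha0 h0₁.symm
  exact Summit.HodgeConjecture.CorCM.dual_ne_smul_of_odd hα hβ ha hb h1₁ h1₂ h0₁ h0₂ t⁻¹
    (by rw [ht, smul_smul, inv_mul_cancel₀ ht0, one_smul])

end Summit.HodgeConjecture.CorCM.IrrOdd

end
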